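import Summits.CriticalPhenomena.PercolationContinuityZ3.Theorems.Transplant.FKConnectivityAllQPat3ShapeThreeK
import Summits.CriticalPhenomena.PercolationContinuityZ3.Theorems.Transplant.FKConnectivityAllQPat3ShapeThreeRep
import HarnessLib

/-!
# Connectivity correlation inequalities for `φ_{w,q}`, every `q > 0` — TABULATED / REPRESENTATIVE CERTIFICATE CHECKING FOR
# THREE-PIECE SHAPES WITH CONTRACTED SKELETON EDGES (census g41; census g40's `…Pat3ShapeThreeTab / …ThreeRep` on `FK.coefTab3K`)

Definitions + theorems file (`--supports stmt-CriticalPhenomena-4575`), census lineage (gen 41) of LANE 2's FK sub-programme; builds on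
p205010 (kernel theorem, internal audit signed; external expert review pending).  No named facts, no sorries; standard axioms.

Census g40's kernel-cheap routes for the `t = 3` leaves (side table literal → coefficient literal (cell-wise) → representative rows,
`…Pat3ShapeThreeTab`, `…Pat3ShapeThreeRep`) are generic in the side table except for the facts tying the literal to the shape; this file
supplies them for the K-state engine `…Pat3ShapeThreeK`: `FK.certCheck3S_specK`, `FK.side3RK`, **`FK.sideCheck3K`** (+ `_spec`),
`FK.coefTab3K_eq_coefSide3`, and the three row assemblies **`FK.rows_of_tab3K`** (25 first-pair loops), **`FK.rows_of_tab3RK`**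
(fifteen representative loops + generator symmetry) and **`FK.rows_of_side3RK`** (no coefficient literal) — each giving the rowwise
domination `8·Σ λ·tensor ≤ Dn·symm8d (coefTab3K L K …)` that `FK.shape3KC_nonneg_of_rows` consumes.  Users: the EEE K-state data files
(kit j242142's certificates: 8 states × {T_sym, STAR_x, STAR_x~, STAR_s} × {triangle, claw, path-end, path-mid}).
[cite: AyyerLinussonRavichandran2025, §7 (p. 22)]
-/

namespace Summit.CriticalPhenomena.PercolationContinuityZ3.Theorems

namespace FK

open SimpleGraph Literature.Probability.LatticeModels Literature.Probability.Percolation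
open scoped Classical

variable {V : Type*}

section TabThreeK

variable {ι : Type*} [DecidableEq ι]

/-- Unpacking a passed three-piece certificate check against `FK.coefTab3K` (all levels). [folklore] -/
theorem certCheck3S_specK {L K : List (ι × ι)} {iK jK kK i1 j1 k1 i2 j2 k2 ix iy is : ι} {F : ℕ → Pat3 → Pat3 → ℤ}
    {prods : List Prod3} {Dn B : ℕ} (hB : 2 * L.length + 2 * K.length + 2 ≤ B)
    (h : certCheck3S (coefTab3K L K iK jK kK i1 j1 k1 i2 j2 k2 ix iy is F) prods Dn B = true) (d : ℕ)
    (PK QK P1 Q1 P2 Q2 : Pat3) :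
    8 * (prods.map fun q => (q.lam : ℤ) * q.tensor d PK QK P1 Q1 P2 Q2).sum ≤
      (Dn : ℤ) * symm8d (coefTab3K L K iK jK kK i1 j1 k1 i2 j2 k2 ix iy is F) d PK QK P1 Q1 P2 Q2 := by
  unfold certCheck3S at h
  rw [Bool.and_eq_true] at h
  obtain ⟨hshift, hmain⟩ := h
  simp only [List.all_eq_true, decide_eq_true_eq] at hshift hmain
  by_cases hd : d < B + 6
  · exact hmain d (List.mem_range.2 hd) PK PK.mem_list QK QK.mem_list P1 P1.mem_list Q1 Q1.mem_list P2 P2.mem_list Q2 Q2.mem_list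
  · rw [not_lt] at hd
    have hz : ∀ A1 A2 A3 A4 A5 A6 : Pat3, coefTab3K L K iK jK kK i1 j1 k1 i2 j2 k2 ix iy is F d A1 A2 A3 A4 A5 A6 = 0 :=
      fun _ _ _ _ _ _ => coefTab3K_eq_zero L K iK jK kK i1 j1 k1 i2 j2 k2 ix iy is F (by omega) _ _ _ _ _ _
    simp only [symm8d, hz, add_zero, mul_zero]
    refine le_of_eq ?_
    rw [List.sum_eq_zero fun x hx => ?_, mul_zero]
    rw [List.mem_map] at hx
    obtain ⟨q, hq, rfl⟩ := hx
    rw [Prod3.tensor_eq_zero_of_le q (hshift q hq) hd, mul_zero]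

/-- The reading of one side of a three-piece shape with contracted skeleton edges: (pattern at the marks, corrections). [folklore] -/
def side3RK (L K : List (ι × ι)) (iK jK kK i1 j1 k1 i2 j2 k2 ix iy is : ι) (bs : List Bool) (PK P1 P2 : Pat3) : Pat3 × ℕ :=
  (rdPat ix iy is (side3K L K iK jK kK i1 j1 k1 i2 j2 k2 bs PK P1 P2).1, (side3K L K iK jK kK i1 j1 k1 i2 j2 k2 bs PK P1 P2).2)

/-- **Side-table check** (three pieces, contracted skeleton edges). [folklore] -/
def sideCheck3K (L K : List (ι × ι)) (iK jK kK i1 j1 k1 i2 j2 k2 ix iy is : ι) (S : List (List (List (List (Pat3 × ℕ))))) : Bool :=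
  (allBits L.length).all fun bs => Pat3.list.all fun PK => Pat3.list.all fun P1 => Pat3.list.all fun P2 =>
    decide (sideGet3 S bs PK P1 P2 = side3RK L K iK jK kK i1 j1 k1 i2 j2 k2 ix iy is bs PK P1 P2)

/-- Unpacking a passed three-piece side-table check (contracted skeleton edges). [folklore] -/
theorem sideCheck3K_spec {L K : List (ι × ι)} {iK jK kK i1 j1 k1 i2 j2 k2 ix iy is : ι} {S : List (List (List (List (Pat3 × ℕ))))}
    (h : sideCheck3K L K iK jK kK i1 j1 k1 i2 j2 k2 ix iy is S = true) {bs : List Bool} (hbs : bs.length = L.length)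
    (PK P1 P2 : Pat3) : sideGet3 S bs PK P1 P2 = side3RK L K iK jK kK i1 j1 k1 i2 j2 k2 ix iy is bs PK P1 P2 := by
  unfold sideCheck3K at h
  simp only [List.all_eq_true, decide_eq_true_eq] at h
  exact h bs (mem_allBits.2 hbs) PK PK.mem_list P1 P1.mem_list P2 P2.mem_list

/-- With a correct side table, census g40's `FK.coefSide3` IS `FK.coefTab3K`. [folklore] -/
theorem coefTab3K_eq_coefSide3 {L K : List (ι × ι)} {iK jK kK i1 j1 k1 i2 j2 k2 ix iy is : ι}
    {S : List (List (List (List (Pat3 × ℕ))))} (h : sideCheck3K L K iK jK kK i1 j1 k1 i2 j2 k2 ix iy is S = true)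
    (F : ℕ → Pat3 → Pat3 → ℤ) (d : ℕ) (PK QK P1 Q1 P2 Q2 : Pat3) :
    coefTab3K L K iK jK kK i1 j1 k1 i2 j2 k2 ix iy is F d PK QK P1 Q1 P2 Q2 = coefSide3 L.length S F d PK QK P1 Q1 P2 Q2 := by
  unfold coefTab3K coefSide3
  refine sumBits_congr_len L.length fun bs hbs => ?_
  have hbs' : (bs.map (! ·)).length = L.length := by rw [List.length_map, hbs]
  have e1 := sideCheck3K_spec h hbs PK P1 P2
  have e2 := sideCheck3K_spec h hbs' QK Q1 Q2
  unfold side3RK at e1 e2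
  rw [e1, e2]

/-- **Rows from the tabulated + filtered checks** (three pieces, contracted skeleton edges; 25 first-pair loops `FK.loop1G`). [folklore] -/
theorem rows_of_tab3K {L K : List (ι × ι)} {iK jK kK i1 j1 k1 i2 j2 k2 ix iy is : ι} {F : ℕ → Pat3 → Pat3 → ℤ}
    {S : List (List (List (List (Pat3 × ℕ))))} {T : List (List (List (List (List (List (List ℤ))))))} {prods : List Prod3}
    {Dn B : ℕ} (hB : 2 * L.length + 2 * K.length + 2 ≤ B) (hS : sideCheck3K L K iK jK kK i1 j1 k1 i2 j2 k2 ix iy is S = true)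
    (hT : coefCheck3 L.length S F T (B + 6) = true) (hlen : T.length ≤ B + 6)
    (hshift : (prods.all fun p => decide (p.shift ≤ B)) = true)
    (hpairs : ∀ PK QK : Pat3, loop1G (symm8d (coefGet3 T)) 8 Dn B (prods.filter fun p => suppAt p.gK PK QK) PK QK = true)
    (d : ℕ) (PK QK P1 Q1 P2 Q2 : Pat3) :
    8 * (prods.map fun q => (q.lam : ℤ) * q.tensor d PK QK P1 Q1 P2 Q2).sum ≤
      (Dn : ℤ) * symm8d (coefTab3K L K iK jK kK i1 j1 k1 i2 j2 k2 ix iy is F) d PK QK P1 Q1 P2 Q2 := by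
  have hz : ∀ d', B + 6 ≤ d' → ∀ A1 A2 A3 A4 A5 A6 : Pat3, coefGet3 T d' A1 A2 A3 A4 A5 A6 = 0 :=
    fun d' hd' _ _ _ _ _ _ => coefGet3_eq_zero (hlen.trans hd') _ _ _ _ _ _
  have key := certCheckG_of_pairs 8 Dn B hshift hpairs
    (fun d' hd' A1 A2 A3 A4 A5 A6 => by simp only [symm8d, hz d' hd', add_zero, le_refl]) d PK QK P1 Q1 P2 Q2
  have e : symm8d (coefTab3K L K iK jK kK i1 j1 k1 i2 j2 k2 ix iy is F) d PK QK P1 Q1 P2 Q2 = symm8d (coefGet3 T) d PK QK P1 Q1 P2 Q2 := by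
    by_cases hd : d < B + 6
    · simp only [symm8d, coefTab3K_eq_coefSide3 hS, coefCheck3_spec hT hd]
    · rw [not_lt] at hd
      have hz' : ∀ A1 A2 A3 A4 A5 A6 : Pat3, coefTab3K L K iK jK kK i1 j1 k1 i2 j2 k2 ix iy is F d A1 A2 A3 A4 A5 A6 = 0 :=
        fun _ _ _ _ _ _ => coefTab3K_eq_zero L K iK jK kK i1 j1 k1 i2 j2 k2 ix iy is F (by omega) _ _ _ _ _ _
      simp only [symm8d, hz', hz d hd, add_zero]
  rw [e]
  exact_mod_cast key

/-- **Rows from the tabulated + representative filtered checks** (three pieces, contracted skeleton edges; fifteen `FK.loop1R` with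
generator symmetry). [folklore] -/
theorem rows_of_tab3RK {L K : List (ι × ι)} {iK jK kK i1 j1 k1 i2 j2 k2 ix iy is : ι} {F : ℕ → Pat3 → Pat3 → ℤ}
    {S : List (List (List (List (Pat3 × ℕ))))} {T : List (List (List (List (List (List (List ℤ))))))} {prods : List Prod3}
    {Dn B : ℕ} (hB : 2 * L.length + 2 * K.length + 2 ≤ B) (hS : sideCheck3K L K iK jK kK i1 j1 k1 i2 j2 k2 ix iy is S = true)
    (hT : coefCheck3 L.length S F T (B + 6) = true) (hlen : T.length ≤ B + 6)
    (hshift : (prods.all fun p => decide (p.shift ≤ B)) = true) (hsym : prodsSym prods = true)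
    (hpairs : ∀ pq ∈ Pat3.pairsLE, loop1R (symm8d (coefGet3 T)) 8 Dn B (prods.filter fun p => suppAt p.gK pq.1 pq.2) pq.1 pq.2 = true)
    (d : ℕ) (PK QK P1 Q1 P2 Q2 : Pat3) :
    8 * (prods.map fun q => (q.lam : ℤ) * q.tensor d PK QK P1 Q1 P2 Q2).sum ≤
      (Dn : ℤ) * symm8d (coefTab3K L K iK jK kK i1 j1 k1 i2 j2 k2 ix iy is F) d PK QK P1 Q1 P2 Q2 := by
  have hz : ∀ d', B + 6 ≤ d' → ∀ A1 A2 A3 A4 A5 A6 : Pat3, coefGet3 T d' A1 A2 A3 A4 A5 A6 = 0 :=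
    fun d' hd' _ _ _ _ _ _ => coefGet3_eq_zero (hlen.trans hd') _ _ _ _ _ _
  have key := certCheckGR_of_pairs 8 Dn B hshift hsym hpairs (symm8d_swapK _) (symm8d_swap1 _) (symm8d_swap2 _)
    (fun d' hd' A1 A2 A3 A4 A5 A6 => by simp only [symm8d, hz d' hd', add_zero, le_refl]) d PK QK P1 Q1 P2 Q2
  have e : symm8d (coefTab3K L K iK jK kK i1 j1 k1 i2 j2 k2 ix iy is F) d PK QK P1 Q1 P2 Q2 = symm8d (coefGet3 T) d PK QK P1 Q1 P2 Q2 := by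
    by_cases hd : d < B + 6
    · simp only [symm8d, coefTab3K_eq_coefSide3 hS, coefCheck3_spec hT hd]
    · rw [not_lt] at hd
      have hz' : ∀ A1 A2 A3 A4 A5 A6 : Pat3, coefTab3K L K iK jK kK i1 j1 k1 i2 j2 k2 ix iy is F d A1 A2 A3 A4 A5 A6 = 0 :=
        fun _ _ _ _ _ _ => coefTab3K_eq_zero L K iK jK kK i1 j1 k1 i2 j2 k2 ix iy is F (by omega) _ _ _ _ _ _
      simp only [symm8d, hz', hz d hd, add_zero]
  rw [e]
  exact_mod_cast key

/-- **Rows from the side table alone** (three pieces, contracted skeleton edges; representative loops against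
`symm8d (coefSide3 |L| S F)`). [folklore] -/
theorem rows_of_side3RK {L K : List (ι × ι)} {iK jK kK i1 j1 k1 i2 j2 k2 ix iy is : ι} {F : ℕ → Pat3 → Pat3 → ℤ}
    {S : List (List (List (List (Pat3 × ℕ))))} {prods : List Prod3} {Dn B : ℕ} (hB : 2 * L.length + 2 * K.length + 2 ≤ B)
    (hS : sideCheck3K L K iK jK kK i1 j1 k1 i2 j2 k2 ix iy is S = true)
    (hshift : (prods.all fun p => decide (p.shift ≤ B)) = true) (hsym : prodsSym prods = true)
    (hpairs : ∀ pq ∈ Pat3.pairsLE,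
      loop1R (symm8d (coefSide3 L.length S F)) 8 Dn B (prods.filter fun p => suppAt p.gK pq.1 pq.2) pq.1 pq.2 = true)
    (d : ℕ) (PK QK P1 Q1 P2 Q2 : Pat3) :
    8 * (prods.map fun q => (q.lam : ℤ) * q.tensor d PK QK P1 Q1 P2 Q2).sum ≤
      (Dn : ℤ) * symm8d (coefTab3K L K iK jK kK i1 j1 k1 i2 j2 k2 ix iy is F) d PK QK P1 Q1 P2 Q2 := by
  have e : ∀ d' A1 A2 A3 A4 A5 A6, symm8d (coefSide3 L.length S F) d' A1 A2 A3 A4 A5 A6 =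
      symm8d (coefTab3K L K iK jK kK i1 j1 k1 i2 j2 k2 ix iy is F) d' A1 A2 A3 A4 A5 A6 := fun d' A1 A2 A3 A4 A5 A6 => by
    simp only [symm8d, coefTab3K_eq_coefSide3 hS]
  have key := certCheckGR_of_pairs 8 Dn B hshift hsym hpairs (symm8d_swapK _) (symm8d_swap1 _) (symm8d_swap2 _)
    (fun d' hd' A1 A2 A3 A4 A5 A6 => by
      have hz : ∀ B1 B2 B3 B4 B5 B6 : Pat3, coefTab3K L K iK jK kK i1 j1 k1 i2 j2 k2 ix iy is F d' B1 B2 B3 B4 B5 B6 = 0 :=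
        fun _ _ _ _ _ _ => coefTab3K_eq_zero L K iK jK kK i1 j1 k1 i2 j2 k2 ix iy is F (by omega) _ _ _ _ _ _
      rw [e]; simp only [symm8d, hz, add_zero, le_refl]) d PK QK P1 Q1 P2 Q2
  rw [e] at key
  exact_mod_cast key

end TabThreeK

end FK

end Summit.CriticalPhenomena.PercolationContinuityZ3.Theorems
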